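import Mathlib.GroupTheory.Perm.Fin
import Mathlib.GroupTheory.Perm.Cycle.Concrete
import Mathlib.Tactic.FinCases
import Mathlib.Tactic.Group
import Mathlib.GroupTheory.Perm.Cycle.Type
import HarnessLib

/-!
# Venture HSemireg — a subgroup of `S₄` normalised by a 4-cycle contains its square

Seat w1-tw-1 of the computation cell `pub-hsemireg` (W1, CC note §26.7 (P) of
`widen/W1/CLEAN-COMPONENT-THEOREM-w1tw1.md`, PROPOSITION L² (iii)). There a normal excess surface germ over
a multiplicity-four face point carries a four-sheeted local cover whose monodromy group `M ⊆ S₄` is generated by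
a 4-cycle `c` (the meridian of the face plane) together with a subgroup `K` normalised by `c` (the normal closure
of the other meridians), and the face windings realised by closed loops on the germ contain every `w` with
`c ^ w ∈ K`. The dichotomy used there is the purely group-theoretic fact recorded in this file:

* `sq_mem_of_mem_of_ne_one` — if `K ≤ S₄` is normalised by the 4-cycle `finRotate 4` and contains some
  `k ≠ 1`, then `(finRotate 4) ^ 2 ∈ K`;
* `eq_bot_or_sq_mem` — hence `K = ⊥` or `(finRotate 4) ^ 2 ∈ K`;
* `eq_bot_or_sq_mem_of_cycleType` — the same for an arbitrary 4-cycle `c` (`c.cycleType = {4}`), by conjugacy.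

The proof of the first statement is a finite verification: for each of the 23 non-identity `k ∈ S₄` the square
`(finRotate 4) ^ 2` is an explicit product of at most four of the conjugates `cⁱ k c⁻ⁱ`, all of which lie in `K`.

HONEST FRAMING. Elementary finite group theory inside `Equiv.Perm (Fin 4)`; no curve, surface, Jacobian or
semiregularity map appears; nothing here says that HC, HC_CM or HC_AV holds, and nothing here is a new case of
anything.
-/

namespace Summit.Ventures.HSemireg

namespace FourCycleNormalizesSquare

open Equiv Equiv.Perm

set_option maxRecDepth 8192 in
/-- **Key finite fact.** A subgroup of `S₄ = Equiv.Perm (Fin 4)` that is normalised by the 4-cycle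
`finRotate 4` and contains a non-identity element contains `(finRotate 4) ^ 2`. -/
theorem sq_mem_of_mem_of_ne_one (K : Subgroup (Perm (Fin 4)))
    (hK : ∀ x ∈ K, finRotate 4 * x * (finRotate 4)⁻¹ ∈ K) {k : Perm (Fin 4)} (hkK : k ∈ K)
    (hk : k ≠ 1) : (finRotate 4) ^ 2 ∈ K := by
  have h0 : k ∈ K := hkK
  have h1 : finRotate 4 * k * (finRotate 4)⁻¹ ∈ K := hK _ h0
  have h2 : finRotate 4 * (finRotate 4 * k * (finRotate 4)⁻¹) * (finRotate 4)⁻¹ ∈ K := hK _ h1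
  have h3 : finRotate 4 * (finRotate 4 * (finRotate 4 * k * (finRotate 4)⁻¹) * (finRotate 4)⁻¹)
      * (finRotate 4)⁻¹ ∈ K := hK _ h2
  fin_cases k
  · exact absurd (by decide) hk
  · have W := K.mul_mem (K.mul_mem (K.mul_mem h0 h1) h3) h0
    convert W using 1
    decide
  · have W := K.mul_mem (K.mul_mem (K.mul_mem h0 h1) h3) h0
    convert W using 1
    decide
  · have W := K.mul_mem h0 h3
    convert W using 1
    decide
  · have W := K.mul_mem h0 h1
    convert W using 1
    decide
  · have W := K.mul_mem h0 h1
    convert W using 1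
    decide
  · have W := K.mul_mem (K.mul_mem (K.mul_mem h0 h1) h3) h0
    convert W using 1
    decide
  · have W := K.mul_mem h0 h1
    convert W using 1
    decide
  · have W := K.mul_mem h0 h3
    convert W using 1
    decide
  · have W := K.mul_mem h0 h0
    convert W using 1
    decide
  · have W := K.mul_mem h0 h3
    convert W using 1
    decide
  · have W := K.mul_mem (K.mul_mem (K.mul_mem h0 h0) h1) h1
    convert W using 1
    decide
  · have W := K.mul_mem h0 h1
    convert W using 1
    decide
  · have W := K.mul_mem h0 h3
    convert W using 1
    decide
  · have W := K.mul_mem h0 h1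
    convert W using 1
    decide
  · have W := K.mul_mem (K.mul_mem (K.mul_mem h0 h0) h1) h1
    convert W using 1
    decide
  · have W := h0
    convert W using 1
    decide
  · have W := K.mul_mem (K.mul_mem (K.mul_mem h0 h0) h1) h1
    convert W using 1
    decide
  · have W := K.mul_mem (K.mul_mem (K.mul_mem h0 h1) h3) h0
    convert W using 1
    decide
  · have W := K.mul_mem h0 h1
    convert W using 1
    decide
  · have W := K.mul_mem h0 h1
    convert W using 1
    decide
  · have W := K.mul_mem (K.mul_mem (K.mul_mem h0 h0) h1) h1
    convert W using 1
    decide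
  · have W := K.mul_mem h0 h1
    convert W using 1
    decide
  · have W := K.mul_mem h0 h0
    convert W using 1
    decide

/-- **Dichotomy.** A subgroup of `S₄` normalised by the 4-cycle `finRotate 4` is trivial or contains
`(finRotate 4) ^ 2`. -/
theorem eq_bot_or_sq_mem (K : Subgroup (Perm (Fin 4)))
    (hK : ∀ x ∈ K, finRotate 4 * x * (finRotate 4)⁻¹ ∈ K) :
    K = ⊥ ∨ (finRotate 4) ^ 2 ∈ K := by
  by_cases h : K = ⊥
  · exact Or.inl h
  · obtain ⟨k, hk⟩ := (Subgroup.ne_bot_iff_exists_ne_one).mp h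
    exact Or.inr (sq_mem_of_mem_of_ne_one K hK (k := (k : Perm (Fin 4))) k.2
      (fun h' => hk (Subtype.ext h')))

/-- **The same for an arbitrary 4-cycle.** If `c ∈ S₄` is a 4-cycle (`c.cycleType = {4}`) and the subgroup
`K` is normalised by `c`, then `K = ⊥` or `c ^ 2 ∈ K` (reduction to `finRotate 4` by conjugacy of
permutations with equal cycle type). -/
theorem eq_bot_or_sq_mem_of_cycleType (c : Perm (Fin 4)) (hc : c.cycleType = {4})
    (K : Subgroup (Perm (Fin 4))) (hK : ∀ x ∈ K, c * x * c⁻¹ ∈ K) :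
    K = ⊥ ∨ c ^ 2 ∈ K := by
  have hr : (finRotate 4).cycleType = {4} := by
    show (finRotate (2 + 2)).cycleType = {2 + 2}
    exact cycleType_finRotate
  obtain ⟨g, hg⟩ : ∃ g : Perm (Fin 4), g * finRotate 4 * g⁻¹ = c :=
    isConj_iff.mp (isConj_iff_cycleType_eq.mpr (hr.trans hc.symm))
  -- pull `K` back along conjugation by `g`
  let K' : Subgroup (Perm (Fin 4)) := K.comap (MulAut.conj g).toMonoidHom
  have memK' : ∀ x, x ∈ K' ↔ g * x * g⁻¹ ∈ K := fun x => by
    simp [K', Subgroup.mem_comap]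
  have hK' : ∀ x ∈ K', finRotate 4 * x * (finRotate 4)⁻¹ ∈ K' := by
    intro x hx
    rw [memK'] at hx ⊢
    have h1 := hK _ hx
    rw [← hg] at h1
    have e : g * finRotate 4 * g⁻¹ * (g * x * g⁻¹) * (g * finRotate 4 * g⁻¹)⁻¹
        = g * (finRotate 4 * x * (finRotate 4)⁻¹) * g⁻¹ := by group
    rw [e] at h1
    exact h1
  rcases eq_bot_or_sq_mem K' hK' with h | h
  · left
    refine (Subgroup.eq_bot_iff_forall _).mpr fun y hy => ?_
    have hy' : g⁻¹ * y * g ∈ K' := by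
      rw [memK']
      have e : g * (g⁻¹ * y * g) * g⁻¹ = y := by group
      rw [e]; exact hy
    rw [h] at hy'
    have : g⁻¹ * y * g = 1 := (Subgroup.mem_bot).mp hy'
    calc y = g * (g⁻¹ * y * g) * g⁻¹ := by group
      _ = 1 := by rw [this]; group
  · right
    rw [memK'] at h
    have e : g * (finRotate 4) ^ 2 * g⁻¹ = c ^ 2 := by rw [← hg, pow_two, pow_two]; group
    rw [e] at h
    exact h

end FourCycleNormalizesSquare

end Summit.Ventures.HSemireg
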